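import Mathlib.Analysis.InnerProductSpace.l2Space
import Mathlib.MeasureTheory.Function.L2Space
import Mathlib.MeasureTheory.Integral.Prod
import Mathlib.MeasureTheory.Function.StronglyMeasurable.Lp
import HarnessLib

/-!
# The Hilbert–Schmidt norm of an integral operator with bounded kernel:
`Σ_i ‖T_K e_i‖² = ∬ |K(x, y)|² dμ(y) dμ(x)`
(Bump, *Automorphic Forms and Representations* (1997), Thm. 2.3.2 and eq. (3.3) of its proof,
PDF pp. 159–160; Reed–Simon I, Thm. VI.23)

Topic `Analysis/OperatorTheory`; theorems only (no definition, no named fact, no instance).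

Let `(X, μ)` be a finite measure space, `𝕜 = ℝ` or `ℂ`, and `K : X × X → 𝕜` a bounded (jointly,
strongly) measurable kernel, with integral operator `(T_K φ)(x) = ∫_X K(x, y) φ(y) dμ(y)`. For
every countable Hilbert basis `(e_i)` of `L²(X, μ)`:

* `hasSum_norm_sq_integral_kernel_mul` — for every `x`,
  `Σ_i |(T_K e_i)(x)|² = ∫_X |K(x, y)|² dμ(y)` (Parseval for `y ↦ \overline{K(x, y)} ∈ L²`, whose
  inner product with `φ` is `(T_K φ)(x)`, `integral_kernel_mul_eq_inner`);
* `hasSum_integral_norm_sq_integral_kernel_mul` — **the Hilbert–Schmidt identity**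
  `Σ_i ∫_X |(T_K e_i)(x)|² dμ(x) = ∫_X ∫_X |K(x, y)|² dμ(y) dμ(x)` (Bump (1997), eq. (3.3):
  "`Σ_i |f_i|² = ∫ K(x, y) \overline{K(x, y)} dx dy < ∞`", `f_i = T_K φ_i`), by monotone
  convergence (`lintegral_tsum`) from the pointwise identity;
* `memLp_two_integral_kernel_mul`, `norm_toLp_sq_eq_integral_norm_sq` and
  `hasSum_norm_toLp_integral_kernel_mul_sq` — the same with `T_K e_i` regarded as elements of
  `L²(X, μ)`: `Σ_i ‖T_K e_i‖²_{L²} = ‖K‖²_{L²(μ ⊗ μ)}`, i.e. `T_K` is a Hilbert–Schmidt operator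
  with Hilbert–Schmidt norm `‖K‖_{L²}` (Mathlib has no Hilbert–Schmidt class; the identity is
  stated as a `HasSum`).

Boundedness of `K` (rather than `K ∈ L²(μ ⊗ μ)`) is what the application needs and keeps every
section `K(x, ·)` in `L²`: the kernels `K_f` of the operators `R(f)`, `f ∈ C_c(G)`, on `L²` of a
*compact* quotient `G ⧸ H` are continuous, hence bounded
(`Literature.NumberTheory.Automorphic.AutomorphicQuotientKernel` and its continuation; Gelbart
(1975), (9.7), p. 117: "R(f) is an integral operator in (the compact space) X with kernel …"),
and `Σ_i ‖R(f) e_i‖² = tr R(f)^* R(f)` is the quantity `tr R(f * f^*)` compared in the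
trace-formula proof of the Jacquet–Langlands correspondence (Gelbart (1975), Lemma 10.6, (10.10)).
This file is a brick of the inline (D-0026) decomposition of
`Literature.NumberTheory.Automorphic.strong_multiplicity_one_quaternionUnits`.

Mathlib: `HilbertBasis.hasSum_inner_mul_inner` (Parseval), `MeasureTheory.L2.inner_def`,
`MeasureTheory.StronglyMeasurable.integral_prod_right'`, `MeasureTheory.lintegral_tsum`,
`ENNReal.ofReal_tsum_of_nonneg`, `MeasureTheory.ofReal_integral_eq_lintegral_ofReal`. Neither
Mathlib nor the tree had the Hilbert–Schmidt identity for integral operators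
(`lean search 'HilbertSchmidt|integralOperator|hasSum_inner_mul_inner'`: only uses of Parseval
for characters, `Literature.Analysis.Fourier.ParsevalCompactQuotient`).

## References

* D. Bump, *Automorphic Forms and Representations*, Cambridge Stud. Adv. Math. 55 (1997), §2.3,
  Thm. 2.3.2 and eq. (3.3), Prop. 2.3.1 (PDF pp. 159–161 of the held copy) [Bump1997].
* S. Gelbart, *Automorphic forms on adele groups* (1975), §9 (9.7), (9.11), Lemma 10.6 [Gelbart1975].
-/

noncomputable section

open MeasureTheory Filter Topology
open scoped ENNReal NNReal InnerProductSpace ComplexConjugate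

namespace Literature.Analysis.OperatorTheory

variable {X : Type*} [MeasurableSpace X] {μ : Measure X} {𝕜 : Type*} [RCLike 𝕜]

/-! ### `L²` norms as integrals -/

/-- `‖f‖²_{L²} = ∫ ‖f‖² dμ` for the class of `f ∈ ℒ²` (through `‖F‖² = re ⟪F, F⟫` and
`L2.inner_def`). [folklore] -/
theorem norm_toLp_sq_eq_integral_norm_sq {f : X → 𝕜} (hf : MemLp f 2 μ) :
    ‖hf.toLp f‖ ^ 2 = ∫ x, ‖f x‖ ^ 2 ∂μ := by
  rw [← inner_self_eq_norm_sq (𝕜 := 𝕜), L2.inner_def]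
  have h : ∫ x, ⟪(hf.toLp f) x, (hf.toLp f) x⟫_𝕜 ∂μ = ∫ x, ((‖f x‖ ^ 2 : ℝ) : 𝕜) ∂μ := by
    refine integral_congr_ae ?_
    filter_upwards [hf.coeFn_toLp] with x hx
    rw [hx, inner_self_eq_norm_sq_to_K, RCLike.ofReal_pow]
  rw [h, integral_ofReal, RCLike.ofReal_re]

variable [IsFiniteMeasure μ]

/-! ### Sections of a bounded kernel -/

/-- For a bounded kernel on a finite measure space, `y ↦ \overline{K(x, y)}` is in `ℒ²` (the
sections `y ↦ K(x, y)` are strongly measurable: Mathlib's `StronglyMeasurable.of_uncurry_left`).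
[folklore] -/
theorem memLp_two_conj_kernel_section {K : X → X → 𝕜} (hK : StronglyMeasurable (Function.uncurry K))
    {C : ℝ} (hC : ∀ x y, ‖K x y‖ ≤ C) (x : X) : MemLp (fun y => conj (K x y)) 2 μ :=
  MemLp.of_bound
    (RCLike.continuous_conj.comp_aestronglyMeasurable
      (hK.of_uncurry_left (x := x)).aestronglyMeasurable)
    C (Eventually.of_forall fun y => by rw [RCLike.norm_conj]; exact hC x y)

/-- **`(T_K φ)(x)` is an inner product**: `∫ K(x, y) φ(y) dμ(y) = ⟪\overline{K(x, ·)}, φ⟫_{L²}` for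
`φ ∈ L²(X, μ)` (Bump (1997), proof of Thm. 2.3.2: `f_i(x) = ∫ K(x, y) φ_i(y) dy`).
[cite: Bump1997, Ch. 2 §2.3 Thm. 2.3.2 (proof)] -/
theorem integral_kernel_mul_eq_inner {K : X → X → 𝕜} (hK : StronglyMeasurable (Function.uncurry K))
    {C : ℝ} (hC : ∀ x y, ‖K x y‖ ≤ C) (x : X) (φ : Lp 𝕜 2 μ) :
    ∫ y, K x y * φ y ∂μ = ⟪(memLp_two_conj_kernel_section hK hC x).toLp _, φ⟫_𝕜 := by
  rw [L2.inner_def]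
  refine integral_congr_ae ?_
  filter_upwards [(memLp_two_conj_kernel_section (μ := μ) hK hC x).coeFn_toLp] with y hy
  rw [hy, RCLike.inner_apply, RCLike.conj_conj, mul_comm]

/-- **Pointwise Parseval for the kernel**: for a countable Hilbert basis `(e_i)` of `L²(X, μ)` and
every `x`, `Σ_i |∫ K(x, y) e_i(y) dμ(y)|² = ∫ |K(x, y)|² dμ(y)` (Parseval for
`\overline{K(x, ·)} ∈ L²`; Bump (1997), proof of Thm. 2.3.2). [cite: Bump1997, Ch. 2 §2.3 Thm. 2.3.2 (proof)] -/
theorem hasSum_norm_sq_integral_kernel_mul {ι : Type*} {K : X → X → 𝕜}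
    (hK : StronglyMeasurable (Function.uncurry K)) {C : ℝ} (hC : ∀ x y, ‖K x y‖ ≤ C)
    (b : HilbertBasis ι 𝕜 (Lp 𝕜 2 μ)) (x : X) :
    HasSum (fun i => ‖∫ y, K x y * b i y ∂μ‖ ^ 2) (∫ y, ‖K x y‖ ^ 2 ∂μ) := by
  set k : Lp 𝕜 2 μ := (memLp_two_conj_kernel_section hK hC x).toLp _ with hk
  -- Parseval for `k`
  have h := (b.hasSum_inner_mul_inner k k).map RCLike.re RCLike.continuous_re
  have hnorm : ‖k‖ ^ 2 = ∫ y, ‖K x y‖ ^ 2 ∂μ := by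
    rw [hk, norm_toLp_sq_eq_integral_norm_sq]
    simp only [RCLike.norm_conj]
  rw [← hnorm, ← inner_self_eq_norm_sq (𝕜 := 𝕜)]
  convert h using 1
  funext i
  simp only [Function.comp_apply]
  rw [← inner_conj_symm k (b i), RCLike.conj_mul, ← RCLike.ofReal_pow, RCLike.ofReal_re,
    ← inner_conj_symm (b i) k, RCLike.norm_conj, ← integral_kernel_mul_eq_inner hK hC x (b i)]

/-! ### The Hilbert–Schmidt identity -/

/-- `x ↦ (T_K φ)(x) = ∫ K(x, y) φ(y) dμ(y)` is strongly measurable for `φ ∈ L²`. [folklore] -/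
theorem stronglyMeasurable_integral_kernel_mul {K : X → X → 𝕜}
    (hK : StronglyMeasurable (Function.uncurry K)) (φ : Lp 𝕜 2 μ) :
    StronglyMeasurable fun x => ∫ y, K x y * φ y ∂μ :=
  (hK.mul ((Lp.stronglyMeasurable φ).comp_measurable measurable_snd)).integral_prod_right'

/-- `x ↦ ∫ ‖K(x, y)‖² dμ(y)` is strongly measurable. [folklore] -/
theorem stronglyMeasurable_integral_norm_kernel_sq {K : X → X → 𝕜}
    (hK : StronglyMeasurable (Function.uncurry K)) :
    StronglyMeasurable fun x => ∫ y, ‖K x y‖ ^ 2 ∂μ :=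
  (hK.norm.measurable.pow_const 2).stronglyMeasurable.integral_prod_right'

/-- `|(T_K φ)(x)| ≤ C ∫ |φ| dμ` for a kernel bounded by `C`. [folklore] -/
theorem norm_integral_kernel_mul_le {K : X → X → 𝕜} {C : ℝ} (hC : ∀ x y, ‖K x y‖ ≤ C)
    (φ : Lp 𝕜 2 μ) (x : X) : ‖∫ y, K x y * φ y ∂μ‖ ≤ C * ∫ y, ‖φ y‖ ∂μ := by
  have hφ1 : Integrable (fun y => ‖(φ : X → 𝕜) y‖) μ :=
    ((Lp.memLp φ).integrable one_le_two).norm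
  calc ‖∫ y, K x y * φ y ∂μ‖ ≤ ∫ y, C * ‖(φ : X → 𝕜) y‖ ∂μ :=
        norm_integral_le_of_norm_le (hφ1.const_mul C)
          (Eventually.of_forall fun y => by
            rw [norm_mul]
            exact mul_le_mul_of_nonneg_right (hC x y) (norm_nonneg _))
    _ = C * ∫ y, ‖φ y‖ ∂μ := integral_const_mul C _

/-- **`T_K` maps `L²` into `ℒ²`** (indeed into bounded functions) for a bounded kernel on a finite
measure space. [folklore] -/
theorem memLp_two_integral_kernel_mul {K : X → X → 𝕜} (hK : StronglyMeasurable (Function.uncurry K))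
    {C : ℝ} (hC : ∀ x y, ‖K x y‖ ≤ C) (φ : Lp 𝕜 2 μ) :
    MemLp (fun x => ∫ y, K x y * φ y ∂μ) 2 μ :=
  MemLp.of_bound (stronglyMeasurable_integral_kernel_mul hK φ).aestronglyMeasurable
    (C * ∫ y, ‖φ y‖ ∂μ) (Eventually.of_forall fun x => norm_integral_kernel_mul_le hC φ x)

/-- **The Hilbert–Schmidt identity for an integral operator with bounded kernel** (Bump (1997),
Thm. 2.3.2 and eq. (3.3) of its proof; Reed–Simon I, Thm. VI.23). Let `(X, μ)` be a finite measure
space, `K : X × X → 𝕜` strongly measurable and bounded, and `(e_i)_{i ∈ ι}` a countable Hilbert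
basis of `L²(X, μ)`. Then
`Σ_i ∫_X |∫_X K(x, y) e_i(y) dμ(y)|² dμ(x) = ∫_X ∫_X |K(x, y)|² dμ(y) dμ(x)`
(as a `HasSum`): the pointwise Parseval identity `hasSum_norm_sq_integral_kernel_mul` integrated
term by term (monotone convergence, `lintegral_tsum`). [cite: Bump1997, Ch. 2 §2.3 Thm. 2.3.2 eq. (3.3)] -/
theorem hasSum_integral_norm_sq_integral_kernel_mul {ι : Type*} [Countable ι] {K : X → X → 𝕜}
    (hK : StronglyMeasurable (Function.uncurry K)) {C : ℝ} (hC : ∀ x y, ‖K x y‖ ≤ C)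
    (b : HilbertBasis ι 𝕜 (Lp 𝕜 2 μ)) :
    HasSum (fun i => ∫ x, ‖∫ y, K x y * b i y ∂μ‖ ^ 2 ∂μ) (∫ x, ∫ y, ‖K x y‖ ^ 2 ∂μ ∂μ) := by
  -- notation: `g i x = |(T_K e_i)(x)|²`, `S x = ∫ |K(x, ·)|²`
  set g : ι → X → ℝ := fun i x => ‖∫ y, K x y * b i y ∂μ‖ ^ 2 with hg
  set S : X → ℝ := fun x => ∫ y, ‖K x y‖ ^ 2 ∂μ with hS
  have hpars : ∀ x, HasSum (fun i => g i x) (S x) := fun x =>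
    hasSum_norm_sq_integral_kernel_mul hK hC b x
  have hg0 : ∀ i x, 0 ≤ g i x := fun i x => by positivity
  have hS0 : ∀ x, 0 ≤ S x := fun x => integral_nonneg fun y => by positivity
  have hgS : ∀ i x, g i x ≤ S x := fun i x =>
    le_hasSum (hpars x) i fun j _ => hg0 j x
  -- measurability
  have hgm : ∀ i, StronglyMeasurable (g i) := fun i =>
    ((stronglyMeasurable_integral_kernel_mul hK (b i)).norm.measurable.pow_const 2).stronglyMeasurable
  have hSm : StronglyMeasurable S := stronglyMeasurable_integral_norm_kernel_sq hK
  -- bounds and integrability (`S ≤ C'² μ(X)` with `C' = max C 0`)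
  set C' : ℝ := max C 0 with hC'
  have hC'0 : 0 ≤ C' := le_max_right _ _
  have hSle : ∀ x, S x ≤ C' ^ 2 * μ.real Set.univ := by
    intro x
    have h1 : ‖∫ y, ‖K x y‖ ^ 2 ∂μ‖ ≤ C' ^ 2 * μ.real Set.univ :=
      norm_integral_le_of_norm_le_const (Eventually.of_forall fun y => by
        rw [Real.norm_of_nonneg (by positivity)]
        exact pow_le_pow_left₀ (norm_nonneg _) ((hC x y).trans (le_max_left _ _)) 2)
    exact (Real.le_norm_self _).trans h1
  have hSi : Integrable S μ :=
    (integrable_const (C' ^ 2 * μ.real Set.univ)).mono' hSm.aestronglyMeasurable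
      (Eventually.of_forall fun x => by rw [Real.norm_of_nonneg (hS0 x)]; exact hSle x)
  have hgi : ∀ i, Integrable (g i) μ := fun i =>
    hSi.mono' (hgm i).aestronglyMeasurable
      (Eventually.of_forall fun x => by rw [Real.norm_of_nonneg (hg0 i x)]; exact hgS i x)
  -- monotone convergence in `ℝ≥0∞`
  have key : ENNReal.ofReal (∫ x, S x ∂μ) = ∑' i, ENNReal.ofReal (∫ x, g i x ∂μ) := by
    rw [ofReal_integral_eq_lintegral_ofReal hSi (Eventually.of_forall hS0)]
    have h1 : (fun x => ENNReal.ofReal (S x)) = fun x => ∑' i, ENNReal.ofReal (g i x) := by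
      funext x
      rw [← (hpars x).tsum_eq, ENNReal.ofReal_tsum_of_nonneg (fun i => hg0 i x) (hpars x).summable]
    rw [h1, lintegral_tsum fun i =>
      ((hgm i).measurable.ennreal_ofReal).aemeasurable]
    refine tsum_congr fun i => ?_
    rw [ofReal_integral_eq_lintegral_ofReal (hgi i) (Eventually.of_forall (hg0 i))]
  -- back to `ℝ`
  have hne : ∀ i, ENNReal.ofReal (∫ x, g i x ∂μ) ≠ ∞ := fun i => ENNReal.ofReal_ne_top
  have htop : ∑' i, ENNReal.ofReal (∫ x, g i x ∂μ) ≠ ∞ := by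
    rw [← key]; exact ENNReal.ofReal_ne_top
  have hsummable : Summable fun i => ∫ x, g i x ∂μ := by
    have h1 := ENNReal.summable_toReal htop
    simpa only [ENNReal.toReal_ofReal (integral_nonneg (hg0 _))] using h1
  refine hsummable.hasSum_iff.2 ?_
  have h2 := congrArg ENNReal.toReal key
  rw [ENNReal.toReal_ofReal (integral_nonneg hS0), ENNReal.tsum_toReal_eq hne] at h2
  simp only [ENNReal.toReal_ofReal (integral_nonneg (hg0 _))] at h2
  exact h2.symm

/-- **Hilbert–Schmidt norm of `T_K` on `L²`**: with `T_K e_i ∈ L²(X, μ)`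
(`memLp_two_integral_kernel_mul`), `Σ_i ‖T_K e_i‖²_{L²} = ∫_X ∫_X |K(x, y)|² dμ(y) dμ(x)`,
i.e. `T_K` is a Hilbert–Schmidt operator with Hilbert–Schmidt norm `‖K‖_{L²(μ ⊗ μ)}` (Bump (1997),
Thm. 2.3.2: "such an integral operator is called a Hilbert–Schmidt operator").
[cite: Bump1997, Ch. 2 §2.3 Thm. 2.3.2 eq. (3.3)] -/
theorem hasSum_norm_toLp_integral_kernel_mul_sq {ι : Type*} [Countable ι] {K : X → X → 𝕜}
    (hK : StronglyMeasurable (Function.uncurry K)) {C : ℝ} (hC : ∀ x y, ‖K x y‖ ≤ C)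
    (b : HilbertBasis ι 𝕜 (Lp 𝕜 2 μ)) :
    HasSum (fun i => ‖(memLp_two_integral_kernel_mul hK hC (b i)).toLp _‖ ^ 2)
      (∫ x, ∫ y, ‖K x y‖ ^ 2 ∂μ ∂μ) := by
  have h := hasSum_integral_norm_sq_integral_kernel_mul hK hC b
  convert h using 1
  funext i
  exact norm_toLp_sq_eq_integral_norm_sq _

end Literature.Analysis.OperatorTheory
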